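import Literature.AnabelianGeometry.SemiGraphs.PSCTwoComponentAffineFreeFactors
import Literature.AnabelianGeometry.SemiGraphs.PSCTwoComponentUnrProp12AllShapes
import HarnessLib

/-!
# [CombGC] Prop. 1.2 (ii) IN FULL at two-component data POINTED ON BOTH SIDES (components with ONE marked point included)

Mochizuki, *A combinatorial version of the Grothendieck conjecture*, Tohoku Math. J. **59** (2007)
[CombGC], Prop. 1.2 (ii) p. 8 [cite: MochizukiCombGC2007, Prop 1.2(ii) p.8]: "the `Aᵢ` [verticial and
edge-like subgroups] are commensurably terminal in `Π_G`; … [for `G` sturdy] the `Bᵢ` are commensurably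
terminal in `Π^unr_G`".  abc-iut FACT-LIST row F-0438 `PSCDatum.CommensurableTerminalityHolds` (schema over
`Ω : PSCOrigin`, abc-iut-L3-t4; universal closure refuted, instance forms at genuine carriers the content).

PROOF-ONLY file (abc-iut-f-164 gen 4), closing gen 3's resume point (ii) for Prop. 1.2 (ii): the data of
two-component shape POINTED ON BOTH SIDES of gen 2 (`PSCTwoComponentAffinePointedOrigin.lean`: `C₀ ∪_ν C₁`,
`1 ≤ s ≤ r − 1` marked points on `C₁`, so a component may carry a SINGLE marked point; `ι : Γ_{g,r} → Π` a
profinite pro-`Σ` completion).  Gen 3's free-factor route needed `s ≥ 2`, `r − s ≥ 2` only for the incidence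
facts (Prop. 1.5 (i)); for commensurable terminality the node-loop basis `b'` of abc-iut-f-166
(`exists_freeGroupBasis_nodeLoop`, `1 ≤ s ≤ r − 1`) already carries BOTH vertex groups
(`closure_firstSubsurface_eq_nodeLoopBasis`, `closure_secondSubsurface_eq_nodeLoopBasis`) and the node group
(the member `ε`) as sub-basis closures, so abc-iut-L5-t6's `freeFactor_isCommensurablyTerminal` and the
cusp-inertia theorem `cuspInertia_closure_isCommensurablyTerminal` give the first clause; the sturdy
`Π^unr`-clause is `unrRows_of_twoComponent` (`PSCTwoComponentUnrProp12AllShapes.lean`).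

* `verticialEdgeLikeCommensurablyTerminal_of_twoComponentPointed`, `commensurablyTerminal_of_twoComponentPointed`
  — Prop. 1.2 (ii), first clause resp. BOTH clauses, at every two-component datum pointed on both sides;
* `twoComponentPointedOrigin_commensurableTerminalityHolds` — **F-0438 at every origin of such data** (gen 2's
  origin hypothesis BY NAME; any genera).

Instance forms at data of the shape of genuine two-component curves: consistency evidence for the typed
schema, not the printed theorem for all pointed stable curves (cell FOUNDATIONS rows 13–14).  0 definitions;
nothing here takes a side on [IUTchIII] Cor. 3.12.
-/

noncomputable section

namespace Literature.AnabelianGeometry.SemiGraphs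

namespace PSCDatum

open scoped Pointwise
open Literature.GroupTheory.CombinatorialGroupTheory
open Literature.GroupTheory.CombinatorialGroupTheory.PuncturedSurfaceGroup (a b c cuspInertia
  exists_freeGroupBasis_nodeLoop closure_firstSubsurface_eq_nodeLoopBasis
  closure_secondSubsurface_eq_nodeLoopBasis)
open SemiGraphOfAnabelioids (IsProSigmaCompletion cuspInertia_closure_isCommensurablyTerminal)
open SemiGraphOfAnabelioids.IsProSigmaCompletion (freeFactor_isCommensurablyTerminal)

section Datum

variable {P : Type} [Group P] [TopologicalSpace P] [IsTopologicalGroup P]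
variable [CompactSpace P] [T2Space P] [TotallyDisconnectedSpace P] {Sigma : Set ℕ} {g r : ℕ}

/-- **[CombGC] Prop. 1.2 (ii), first clause, at every two-component datum pointed on both sides**
(`1 ≤ s ≤ r − 1`; `(g, r)` hyperbolic): verticial and edge-like subgroups are commensurably terminal in
`Π_G` — `Π_{v₀}`, `Π_{v₁}`, `Π_ν` as free factors of ONE node-loop basis, cusp groups by the cusp-inertia
theorem. [cite: MochizukiCombGC2007, Prop 1.2(ii) p.8] -/
theorem verticialEdgeLikeCommensurablyTerminal_of_twoComponentPointed (hne : Sigma.Nonempty)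
    (hprime : ∀ p ∈ Sigma, p.Prime) (ι : PuncturedSurfaceGroup g r →* P)
    (hι : IsProSigmaCompletion Sigma ι) (G : PSCDatum P) {g₀ s : ℕ} (hs : 1 ≤ s) (hsr : s + 1 ≤ r)
    (hhyp : PuncturedSurfaceGroup.IsHyperbolicType g r) (e : G.graph.C ≃ Fin r)
    (hC : ∀ c', G.cuspGp c' = ((cuspInertia (g := g) (e c')).map ι).topologicalClosure)
    (v₀ v₁ : G.graph.V) (hV : ∀ w, w = v₀ ∨ w = v₁) (ε : PuncturedSurfaceGroup g r)
    (hε : ε = ((List.finRange r).map fun j : Fin r =>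
          if s ≤ (j : ℕ) then PuncturedSurfaceGroup.c (g := g) j else 1).prod *
        ((List.finRange g).map fun i : Fin g => if (i : ℕ) < g₀ then
          PuncturedSurfaceGroup.a (r := r) i * PuncturedSurfaceGroup.b i *
            (PuncturedSurfaceGroup.a i)⁻¹ * (PuncturedSurfaceGroup.b i)⁻¹ else 1).prod)
    (hV₀ : G.vertGp v₀ = ((Subgroup.closure {x : PuncturedSurfaceGroup g r |
        (∃ i : Fin g, (i : ℕ) < g₀ ∧ (x = PuncturedSurfaceGroup.a i ∨ x = PuncturedSurfaceGroup.b i)) ∨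
        ∃ j : Fin r, s ≤ (j : ℕ) ∧ x = PuncturedSurfaceGroup.c j}).map ι).topologicalClosure)
    (hV₁ : G.vertGp v₁ = ((Subgroup.closure {x : PuncturedSurfaceGroup g r |
        (∃ i : Fin g, g₀ ≤ (i : ℕ) ∧ (x = PuncturedSurfaceGroup.a i ∨ x = PuncturedSurfaceGroup.b i)) ∨
        (∃ j : Fin r, (j : ℕ) < s ∧ x = PuncturedSurfaceGroup.c j) ∨ x = ε}).map ι).topologicalClosure)
    (n₀ : G.graph.N) (hN : ∀ n, n = n₀)
    (hE : G.nodeGp n₀ = ((Subgroup.zpowers ε).map ι).topologicalClosure) :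
    G.VerticialEdgeLikeCommensurablyTerminal := by
  classical
  obtain ⟨r', rfl⟩ : ∃ r', r = r' + 1 := ⟨r - 1, by omega⟩
  have hp : ∃ p ∈ Sigma, p.Prime := hne.imp fun p hp => ⟨hp, hprime p hp⟩
  -- the node-loop basis
  obtain ⟨b', ha', hb', hc', hk'⟩ := exists_freeGroupBasis_nodeLoop g r' g₀ s (by omega) (by omega) ε hε
  have hk : ∀ h : s - 1 < r', b' (Sum.inr ⟨s - 1, h⟩) = ε := fun _ => hk'
  set S₀ : Set ((Fin g × Bool) ⊕ Fin r') :=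
    {x | Sum.elim (fun p : Fin g × Bool => (p.1 : ℕ) < g₀) (fun j : Fin r' => s ≤ (j : ℕ) + 1) x} with hS₀
  set T₁ : Set ((Fin g × Bool) ⊕ Fin r') :=
    {x | Sum.elim (fun p : Fin g × Bool => g₀ ≤ (p.1 : ℕ)) (fun j : Fin r' => (j : ℕ) + 1 ≤ s) x} with hT₁
  have hSr : ∀ j : Fin r', (Sum.inr j : (Fin g × Bool) ⊕ Fin r') ∈ S₀ ↔ s ≤ (j : ℕ) + 1 := fun _ => Iff.rfl
  have hTr : ∀ j : Fin r', (Sum.inr j : (Fin g × Bool) ⊕ Fin r') ∈ T₁ ↔ (j : ℕ) + 1 ≤ s := fun _ => Iff.rfl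
  set σ : (Fin g × Bool) ⊕ Fin r' := Sum.inr ⟨s - 1, by omega⟩ with hσ
  have hσS : σ ∈ S₀ := (hSr _).mpr (by simp only; omega)
  have hσT : σ ∈ T₁ := (hTr _).mpr (by simp only; omega)
  -- the three non-cuspidal representatives as sub-basis closures of `b'`
  have hA₀ : G.vertGp v₀ = ((Subgroup.closure (b' '' S₀)).map ι).topologicalClosure := by
    rw [hV₀, closure_firstSubsurface_eq_nodeLoopBasis hε ha' hb' hc' hk (by omega) (by omega)]
  have hA₁ : G.vertGp v₁ = ((Subgroup.closure (b' '' T₁)).map ι).topologicalClosure := by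
    rw [hV₁, closure_secondSubsurface_eq_nodeLoopBasis hε ha' hb' hc' hk (by omega) (by omega)]
  have hN₀ : G.nodeGp n₀ = ((Subgroup.closure (b' '' {σ})).map ι).topologicalClosure := by
    rw [hE, closure_image_singleton, hσ, hk (by omega)]
  refine G.verticialEdgeLikeCommensurablyTerminal_of (fun v => ?_) (fun n => ?_) (fun c' => ?_)
  · rcases hV v with rfl | rfl
    · rw [hA₀]; exact freeFactor_isCommensurablyTerminal b' _ ⟨σ, hσS⟩ hι hp
    · rw [hA₁]; exact freeFactor_isCommensurablyTerminal b' _ ⟨σ, hσT⟩ hι hp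
  · rw [hN n, hN₀]; exact freeFactor_isCommensurablyTerminal b' _ ⟨σ, rfl⟩ hι hp
  · rw [hC]; exact cuspInertia_closure_isCommensurablyTerminal hne hprime hhyp ι hι (e c')

/-- **[CombGC] Prop. 1.2 (ii), BOTH clauses, at every two-component datum pointed on both sides**
(`1 ≤ s ≤ r − 1`, `(g, r)` hyperbolic, genus pins): verticial and edge-like subgroups are commensurably
terminal in `Π_G`, AND (sturdy data) unramified verticial subgroups are commensurably terminal in `Π^unr_G`
(`unrRows_of_twoComponent`). [cite: MochizukiCombGC2007, Prop 1.2(ii) p.8] -/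
theorem commensurablyTerminal_of_twoComponentPointed (hne : Sigma.Nonempty)
    (hprime : ∀ p ∈ Sigma, p.Prime) (ι : PuncturedSurfaceGroup g r →* P)
    (hι : IsProSigmaCompletion Sigma ι) (G : PSCDatum P) {g₀ s : ℕ} (hs : 1 ≤ s) (hsr : s + 1 ≤ r)
    (hhyp : PuncturedSurfaceGroup.IsHyperbolicType g r) (e : G.graph.C ≃ Fin r)
    (hC : ∀ c', G.cuspGp c' = ((cuspInertia (g := g) (e c')).map ι).topologicalClosure)
    (v₀ v₁ : G.graph.V) (hV : ∀ w, w = v₀ ∨ w = v₁) (ε : PuncturedSurfaceGroup g r)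
    (hε : ε = ((List.finRange r).map fun j : Fin r =>
          if s ≤ (j : ℕ) then PuncturedSurfaceGroup.c (g := g) j else 1).prod *
        ((List.finRange g).map fun i : Fin g => if (i : ℕ) < g₀ then
          PuncturedSurfaceGroup.a (r := r) i * PuncturedSurfaceGroup.b i *
            (PuncturedSurfaceGroup.a i)⁻¹ * (PuncturedSurfaceGroup.b i)⁻¹ else 1).prod)
    (hV₀ : G.vertGp v₀ = ((Subgroup.closure {x : PuncturedSurfaceGroup g r |
        (∃ i : Fin g, (i : ℕ) < g₀ ∧ (x = PuncturedSurfaceGroup.a i ∨ x = PuncturedSurfaceGroup.b i)) ∨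
        ∃ j : Fin r, s ≤ (j : ℕ) ∧ x = PuncturedSurfaceGroup.c j}).map ι).topologicalClosure)
    (hV₁ : G.vertGp v₁ = ((Subgroup.closure {x : PuncturedSurfaceGroup g r |
        (∃ i : Fin g, g₀ ≤ (i : ℕ) ∧ (x = PuncturedSurfaceGroup.a i ∨ x = PuncturedSurfaceGroup.b i)) ∨
        (∃ j : Fin r, (j : ℕ) < s ∧ x = PuncturedSurfaceGroup.c j) ∨ x = ε}).map ι).topologicalClosure)
    (n₀ : G.graph.N) (hN : ∀ n, n = n₀)
    (hE : G.nodeGp n₀ = ((Subgroup.zpowers ε).map ι).topologicalClosure)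
    (hgen₀ : G.genus v₀ = g₀) (hgen₁ : G.genus v₁ = g - g₀) :
    G.VerticialEdgeLikeCommensurablyTerminal ∧ G.UnrVerticialCommensurablyTerminal :=
  ⟨G.verticialEdgeLikeCommensurablyTerminal_of_twoComponentPointed hne hprime ι hι hs hsr hhyp e hC v₀ v₁ hV ε
      hε hV₀ hV₁ n₀ hN hE,
    (G.unrRows_of_twoComponent hne hprime ι hι e hC n₀ hN v₀ v₁ hV ε hε hV₀ hV₁ hE hgen₀ hgen₁).2.2⟩

end Datum

/-! ### F-0438 at every origin of two-component data pointed on both sides -/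

/-- **F-0438 `CommensurableTerminalityHolds Ω` (BOTH clauses) at EVERY origin whose data are of
two-component shape pointed on both sides** — gen 2's origin hypothesis of
`PSCTwoComponentAffinePointedOrigin.lean` BY NAME (`1 ≤ s ≤ r − 1`, stability side conditions, any genera;
profinite `Π` in `Type`): in particular at components with a SINGLE marked point.
[cite: MochizukiCombGC2007, Prop 1.2(ii) p.8] -/
theorem twoComponentPointedOrigin_commensurableTerminalityHolds (Ω : PSCOrigin.{0})
    (hΩ : ∀ ⦃Q : Type⦄ [Group Q] [TopologicalSpace Q] [IsTopologicalGroup Q] (G : PSCDatum Q),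
      Ω.IsOfPSCType G → CompactSpace Q ∧ T2Space Q ∧ TotallyDisconnectedSpace Q ∧
        ∃ (S : Set ℕ) (g r g₀ s : ℕ) (ι : PuncturedSurfaceGroup g r →* Q) (e : G.graph.C ≃ Fin r)
          (v₀ v₁ : G.graph.V) (n₀ : G.graph.N) (ε : PuncturedSurfaceGroup g r),
          S.Nonempty ∧ (∀ p ∈ S, p.Prime) ∧ IsProSigmaCompletion S ι ∧ g₀ ≤ g ∧ 1 ≤ s ∧ s + 1 ≤ r ∧
          (1 ≤ g₀ ∨ 2 ≤ r - s) ∧ (1 ≤ g - g₀ ∨ 2 ≤ s) ∧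
          (∀ c, G.cuspGp c =
            ((PuncturedSurfaceGroup.cuspInertia (g := g) (e c)).map ι).topologicalClosure) ∧
          (∀ w, w = v₀ ∨ w = v₁) ∧ (∀ n, n = n₀) ∧
          ε = ((List.finRange r).map fun j : Fin r =>
            if s ≤ (j : ℕ) then PuncturedSurfaceGroup.c (g := g) j else 1).prod *
          ((List.finRange g).map fun i : Fin g => if (i : ℕ) < g₀ then
            PuncturedSurfaceGroup.a (r := r) i * PuncturedSurfaceGroup.b i *
              (PuncturedSurfaceGroup.a i)⁻¹ * (PuncturedSurfaceGroup.b i)⁻¹ else 1).prod ∧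
          G.vertGp v₀ = ((Subgroup.closure {x : PuncturedSurfaceGroup g r |
            (∃ i : Fin g, (i : ℕ) < g₀ ∧ (x = PuncturedSurfaceGroup.a i ∨ x = PuncturedSurfaceGroup.b i)) ∨
            ∃ j : Fin r, s ≤ (j : ℕ) ∧ x = PuncturedSurfaceGroup.c j}).map ι).topologicalClosure ∧
          G.vertGp v₁ = ((Subgroup.closure {x : PuncturedSurfaceGroup g r |
            (∃ i : Fin g, g₀ ≤ (i : ℕ) ∧ (x = PuncturedSurfaceGroup.a i ∨ x = PuncturedSurfaceGroup.b i)) ∨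
            (∃ j : Fin r, (j : ℕ) < s ∧ x = PuncturedSurfaceGroup.c j) ∨ x = ε}).map ι).topologicalClosure ∧
          G.nodeGp n₀ = ((Subgroup.zpowers ε).map ι).topologicalClosure ∧
          G.genus v₀ = g₀ ∧ G.genus v₁ = g - g₀) :
    CommensurableTerminalityHolds Ω := by
  intro Q _ _ _ G hG
  obtain ⟨hc, ht, hd, S, g, r, g₀, s, ι, e, v₀, v₁, n₀, ε, hne, hprime, hι, hg₀, hs, hsr, hst₀, hst₁, hC,
    hV, hN, hε, hV₀, hV₁, hE, hgen₀, hgen₁⟩ := hΩ G hG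
  haveI := hc
  haveI := ht
  haveI := hd
  have hhyp : PuncturedSurfaceGroup.IsHyperbolicType g r := by
    unfold PuncturedSurfaceGroup.IsHyperbolicType
    rcases hst₀ with h | h <;> rcases hst₁ with h' | h' <;> omega
  exact G.commensurablyTerminal_of_twoComponentPointed hne hprime ι hι hs hsr hhyp e hC v₀ v₁ hV ε hε hV₀ hV₁
    n₀ hN hE hgen₀ hgen₁

end PSCDatum

end Literature.AnabelianGeometry.SemiGraphs

end
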